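import Literature.NumberTheory.EllipticCurves.SharpFlatPAdicLFunctionCoeffField
import Mathlib.RingTheory.PowerSeries.Basic
import HarnessLib

/-!
# `Λ`-coordinates of `Λ_𝒪 = 𝒪⟦X⟧` over `Λ = A⟦X⟧` from an additive `A`-basis of `𝒪` — the `(bvec, crd, hsum)` input of the Coleman-side
# injectivity theorems of piece S2 (`ColemanSideInjective.eq_zero_of_apply_smul_zeta_eq_zero_two[_of_X_of_C]`)

Route `ResidualThetaTransportAtTwo` (RTT), crux RSL_g `ResidualSignedLambdaLowerCMAtTwo` (stmt-BirchSwinnertonDyer-22608); width seat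
`prover-bsd-wall-tp2-p2x-w3` g15 (`--supports 22608 --as helper`, closes nothing). THEOREMS ONLY (no definition, no named fact, no instance,
no `sorry`). Stub plan rev 18 §3 item 4 (ASSEMBLY of `stub_onePairSupply`): the injectivity of `𝒸 = colⁿ ∘ locd₂` on `Λ_𝒪·z` is
`ColemanSideInjective.eq_zero_of_apply_smul_zeta_eq_zero_two` (p689286) / `…_of_X_of_C` (p689690), which take `Λ`-coordinates of `Λ_𝒪` in the form
`(bvec : Fin n → ΛO) (crd : ΛO →+ (Fin n → Λ)) (hsum : ∀ a, ∑ i, j (crd a i) * bvec i = a)`; the habitat supplies an ADDITIVE, `ℤ_p`-SEMILINEAR basis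
`B : (Fin f → ℤ_[p]) ≃+ 𝒪`, `B (z • c) = ι z * B c` (`LambdaLowerBoundO.exists_addEquiv_padicInt_pi`, p679392; `ι = padicIntToCoeffIntegers S`). Here the
triple is manufactured from `(B, hB)` coefficientwise: `bvec i := C (B eᵢ)`, `(crd a)ᵢ := ∑_m (B⁻¹ a_m)ᵢ X^m`, `j := PowerSeries.map ι`.

* `exists_powerSeries_coordinates` — generic: commutative rings `A`, `𝒪`, `ι : A →+* 𝒪`, `B : (Fin f → A) ≃+ 𝒪` with `B (z • c) = ι z * B c`.
* `exists_iwasawaAlgebraO_coordinates` — the pins: `A = ℤ_[p]`, `𝒪 = padicCoeffIntegers S`, `ι = padicIntToCoeffIntegers S`,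
  `Λ_𝒪 = IwasawaAlgebraO S = (padicCoeffIntegers S)⟦X⟧`.

References: [Washington1997] §13.2, §7.1 (`𝒪⟦T⟧ ≅ Λ^{[𝒪:ℤ_p]}` as a `Λ`-module); [Lang1990] Ch. 5 §1. BSD is not proved by any of this; RSL_g (22608)
is not proved here.
-/

set_option autoImplicit false
-- the Theorems namespace of this sub repeats the summit name by design (D-0017 nested layout)
set_option linter.dupNamespace false

noncomputable section

namespace Summit.BirchSwinnertonDyer.BirchSwinnertonDyer.Theorems.ColemanSideInjective

open Literature.NumberTheory.EllipticCurves

/-- **`Λ`-coordinates of `𝒪⟦X⟧` over `A⟦X⟧` from an additive `A`-semilinear basis of `𝒪`.** For `ι : A → 𝒪` a ring map and an additive equivalence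
`B : A^f ≃ 𝒪` with `B (z • c) = ι z · B c`, there are `bvec : Fin f → 𝒪⟦X⟧` and an additive `crd : 𝒪⟦X⟧ → (A⟦X⟧)^f` with
`∑ᵢ (map ι (crd a)ᵢ) · bvecᵢ = a` for every `a ∈ 𝒪⟦X⟧` — namely `bvecᵢ = C (B eᵢ)` and `(crd a)ᵢ = ∑_m (B⁻¹ a_m)ᵢ X^m` (compare coefficients:
`a_m = B (B⁻¹ a_m) = ∑ᵢ ι((B⁻¹ a_m)ᵢ) · B eᵢ`). This is the `(bvec, crd, hsum)` input of `eq_zero_of_apply_smul_zeta_eq_zero_two`.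
[cite: Washington1997, §13.2] -/
theorem exists_powerSeries_coordinates {A 𝒪 : Type*} [CommRing A] [CommRing 𝒪] (ι : A →+* 𝒪) {f : ℕ} (B : (Fin f → A) ≃+ 𝒪)
    (hB : ∀ (z : A) (c : Fin f → A), B (z • c) = ι z * B c) :
    ∃ (bvec : Fin f → PowerSeries 𝒪) (crd : PowerSeries 𝒪 →+ (Fin f → PowerSeries A)),
      ∀ a : PowerSeries 𝒪, ∑ i, PowerSeries.map ι (crd a i) * bvec i = a := by
  classical
  -- the coordinate map, coefficientwise through `B⁻¹`
  let crd : PowerSeries 𝒪 →+ (Fin f → PowerSeries A) :=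
    { toFun := fun a i ↦ PowerSeries.mk fun m ↦ B.symm (PowerSeries.coeff m a) i
      map_zero' := by
        funext i
        ext m
        simp only [map_zero, PowerSeries.coeff_mk, Pi.zero_apply]
      map_add' := fun a b ↦ by
        funext i
        ext m
        simp only [map_add, PowerSeries.coeff_mk, Pi.add_apply] }
  refine ⟨fun i ↦ PowerSeries.C (B (Pi.single i 1)), crd, fun a ↦ ?_⟩
  ext m
  rw [map_sum]
  have hterm : ∀ i, PowerSeries.coeff m (PowerSeries.map ι (crd a i) * PowerSeries.C (B (Pi.single i 1))) =
      B ((B.symm (PowerSeries.coeff m a) i) • Pi.single i 1) := by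
    intro i
    rw [PowerSeries.coeff_mul_C, PowerSeries.coeff_map, hB]
    change ι (PowerSeries.coeff m (PowerSeries.mk fun m ↦ B.symm (PowerSeries.coeff m a) i)) * _ = _
    rw [PowerSeries.coeff_mk]
  simp_rw [hterm]
  rw [← map_sum]
  have hsum : (∑ i, (B.symm (PowerSeries.coeff m a) i) • (Pi.single i 1 : Fin f → A)) = B.symm (PowerSeries.coeff m a) := by
    funext j
    rw [Finset.sum_apply, Finset.sum_eq_single j]
    · rw [Pi.smul_apply, Pi.single_eq_same, smul_eq_mul, mul_one]
    · intro i _ hij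
      rw [Pi.smul_apply, Pi.single_eq_of_ne (Ne.symm hij), smul_zero]
    · intro hj
      exact absurd (Finset.mem_univ j) hj
  rw [hsum, AddEquiv.apply_symm_apply]

/-- **The pins' coordinates**: `A = ℤ_[p]`, `𝒪 = padicCoeffIntegers S`, `ι = padicIntToCoeffIntegers S`, `Λ_𝒪 = IwasawaAlgebraO S = 𝒪⟦X⟧`,
`j = PowerSeries.map (padicIntToCoeffIntegers S)`: from the habitat's additive `ℤ_p`-semilinear basis `(B, hB)` of `𝒪`
(`LambdaLowerBoundO.exists_addEquiv_padicInt_pi`) one gets `(bvec, crd, hsum)` with `∑ᵢ j (crd a i) * bvec i = a` on `IwasawaAlgebraO S` — feed to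
`eq_zero_of_apply_smul_zeta_eq_zero_two[_of_X_of_C]` (after `subst (n_eq_of_theta …)`, so that `n = f`). [cite: Washington1997, §13.2] -/
theorem exists_iwasawaAlgebraO_coordinates {p : ℕ} [Fact p.Prime] (S : Set (PadicAlgCl p)) {f : ℕ}
    (B : (Fin f → ℤ_[p]) ≃+ ↥(padicCoeffIntegers S)) (hB : ∀ (z : ℤ_[p]) (c : Fin f → ℤ_[p]), B (z • c) = padicIntToCoeffIntegers S z * B c) :
    ∃ (bvec : Fin f → IwasawaAlgebraO S) (crd : IwasawaAlgebraO S →+ (Fin f → PowerSeries ℤ_[p])),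
      ∀ a : IwasawaAlgebraO S, ∑ i, PowerSeries.map (padicIntToCoeffIntegers S) (crd a i) * bvec i = a :=
  exists_powerSeries_coordinates (padicIntToCoeffIntegers S) B hB

end Summit.BirchSwinnertonDyer.BirchSwinnertonDyer.Theorems.ColemanSideInjective

end
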